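import Literature.Topology.FourManifolds.ExoticSevenSphere
import Literature.Topology.FourManifolds.HomotopySpheresBPOrderProofs
import Literature.Topology.FourManifolds.SmoothHomologicalOrientationProofs
import HarnessLib

/-!
# Milnor's exotic 7-sphere from the signature leaves (no `|Θ₇| = 28`, no `coker J₇`, no surgery)

Topic `Literature/Topology/FourManifolds`; second pure-proof companion of the wave-0 named fact
`Literature.Topology.FourManifolds.exists_homeomorph_isEmpty_diffeomorph_sphere_seven` (**spc4.S12**;
Milnor, *On manifolds homeomorphic to the 7-sphere*, Ann. of Math. 64 (1956), Thm. 3, p. 403: "For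
`k² ≢ 1 mod 7` the manifold `M⁷ₖ` is homeomorphic to `S⁷` but not diffeomorphic to `S⁷`").
`ExoticSevenSphere.lean` proves spc4.S12 from `|Θ₇| = 28`
(`natCard_homotopySphereClass_seven`, Kervaire–Milnor 1963, table p. 504 — whose tree decomposition
runs through `Θ₇ = bP₈`, i.e. `coker J₇ = 0`, and through the surgery half of Kervaire–Milnor's
Thm. 7.5) together with the topological Poincaré conjecture for *topological* manifolds of
dimension `≥ 5` (`nonempty_homeomorph_sphere_of_five_le`, Newman–Connell). The existence of ONE
exotic sphere needs far less, and this file proves spc4.S12 from the three leaves of the tree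
that mirror the architecture of Milnor's own proof (§1: an invariant `λ(M⁷)` of the smooth
structure, read off any bounding `B⁸` and well defined by Hirzebruch's signature theorem applied
to closed `8`-manifolds; §3–4: an example with `λ ≠ 0`; §2: the example is a topological sphere):

* **invariance** — `HomotopySphere.twoHundredTwentyFour_dvd_of_mem_signatureSet_sphere`
  (`HomotopySpheresBPOrderSignatureLeaves.lean`; Kervaire–Milnor 1963, p. 529–530, Kosinski 1993,
  IX.8.7 first half: every signature `σ(M₀)` of an s-parallelizable `M₀⁸` with `bM₀ = S⁷` is a
  multiple of `σ₂ = 224` — signature theorem, Bott integrality, `ker J₇`; Milnor's §1 uses only the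
  signature theorem, i.e. the factor `7` of `224`);
* **example** — `HomotopySphere.exists_eight_mem_signatureSet` (loc. cit.; Kosinski X.6 p. 216 with
  VI.12 and IX.7.5: Milnor's `E₈`-plumbing `M(8)` is parallelizable, bounded by a homotopy sphere,
  of signature `8`), itself proved in the tree from its geometric half
  `HomotopySphere.exists_intersectionForm_equivalent_e8Form` and the theorem `σ(E₈) = 8`
  (`signature_e8Form_holds`), so both forms are offered below;
* **topological sphere** — Smale's theorem in Milnor's homological form,
  `nonempty_homeomorph_sphere_of_homologySphere_of_five_le` (`SmaleHomologySpheres.lean`; Milnor,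
  *Lectures on the h-cobordism theorem* (1965), §9 Prop. B: the smooth statement on the tree's
  h-cobordism route, through the tree theorem `HomotopySphere.nonempty_homeomorph_sphere_of_propB`),
  in place of the Newman–Connell theorem for topological manifolds (Milnor's §2 uses Reeb's
  two-critical-points criterion on `M⁷ₖ` instead);

plus ONE elementary bridge, needed because the example sphere `Σ = bM(8)` carries its own atlas
while the invariance leaf speaks about the standard `𝕊⁷`:

* **Bredon VI.7.15 on `𝕊⁷`** — `SmoothOrientation.existsUnique_isCompatible 7 𝕊⁷`
  (`SmoothHomologicalOrientation.lean`: every smooth orientation of `𝕊⁷` has a compatible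
  homological `ℤ`-orientation; only existence, only for the standard `7`-sphere, is used).

## The argument (`exists_homeomorph_isEmpty_diffeomorph_sphere_seven_of_signature_leaves`)

Suppose every smooth `7`-manifold (in `Type`) homeomorphic to `𝕊⁷` were diffeomorphic to it. Take
`Σ` with `8 ∈ signatureSet g 2 h Σ` (the `E₈` example: `Σ = bM`, `M` s-parallelizable, oriented so
that `σ(M) = 8`). `Σ` is a homotopy sphere, hence homeomorphic to `𝕊⁷` (Prop. B), hence — by the
assumption — diffeomorphic to it, `ψ : Σ ≅ 𝕊⁷`. Transport the whole datum along `ψ`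
(`HomotopySphere.exists_mem_signatureSet_sphere_of_diffeomorph`, **proved**): the same `M` is a
null-cobordism of `𝕊⁷` via `incl ∘ ψ⁻¹` (`NullCobordism.comap`), the homological orientation `μ`
of `Σ` becomes `μ.comap ψ⁻¹` with fundamental class `ψ_* [Σ]` (`fundamentalClass_comap_holds`), so
`(𝕊⁷, ψ_* μ) = bM` as oriented manifolds with the same relative class, and `ψ_* μ` is `±` the
homological orientation compatible with a fixed smooth orientation `o₀` of `𝕊⁷` (Bredon VI.7.15
and `HomologicalOrientation.eq_or_eq_neg_of_connected_holds`), i.e. compatible with `o₀` or with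
`-o₀` (`SmoothOrientation.IsCompatible.neg`). Hence `8 ∈ signatureSet g 2 h (𝕊⁷, ±o₀)`, and the
invariance leaf gives `224 ∣ 8`: contradiction.

## Also recorded

* `exists_homeomorph_isEmpty_diffeomorph_sphere_seven_of_nontrivial_of_propB`: the reduction of
  `ExoticSevenSphere.lean` (`Θ₇` nontrivial ⇒ spc4.S12) with Prop. B instead of Newman–Connell.
* `nontrivial_homotopySphereClass_seven_of_signature_leaves`: `Θ₇` is nontrivial from the same
  three leaves with Kervaire–Milnor's Thm. 7.5 (`HomotopySphere.mk_eq_mk_iff_sigmaGen_dvd_sub`, only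
  its easy direction is used) in place of Bredon VI.7.15: `[Σ] = [-Σ]` would give `σ₂ ∣ 8 - (-8)`,
  while `224 ∣ σ₂`; whence a second route to spc4.S12
  (`exists_homeomorph_isEmpty_diffeomorph_sphere_seven_of_thm75`).
* The corresponding forms of spc4.S32⁻ (`not_forall_nonemptyDiffeomorphSphere_seven`) follow by
  `not_forall_nonemptyDiffeomorphSphere_seven_of` (`ExoticSevenSphere.lean`).

Everything here is **proved**; no definitions, no new named facts (D-0026). The remaining debt
behind spc4.S12 on this route is exactly: `exists_intersectionForm_equivalent_e8Form` (plumbing),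
`twoHundredTwentyFour_dvd_of_mem_signatureSet_sphere` (signature theorem),
`nonempty_homeomorph_sphere_of_homologySphere_of_five_le` (h-cobordism theorem) and
`SmoothOrientation.existsUnique_isCompatible` at `(7, 𝕊⁷)` (Bredon VI.7.15). The last one is now a
theorem of the tree (`SmoothOrientation.existsUnique_isCompatible_holds`,
`SmoothHomologicalOrientationProofs.lean`); the final section feeds it in, leaving spc4.S12 on the
three deep leaves alone (`exists_homeomorph_isEmpty_diffeomorph_sphere_seven_of_three_leaves`,
`exists_homeomorph_isEmpty_diffeomorph_sphere_seven_of_e8_three_leaves`).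

## References

* J. Milnor, *On manifolds homeomorphic to the 7-sphere*, Ann. of Math. 64 (1956), 399–405: §1
  (the invariant `λ`, Thm. 1), §2 Thm. 2 (p. 401), §3 and Thm. 3 (p. 403). [Milnor1956]
* M. Kervaire, J. Milnor, *Groups of homotopy spheres I*, Ann. of Math. 77 (1963): §7, Lemma 7.4,
  Thm. 7.5, pp. 528–531. [KervaireMilnorAnnals1963]
* A. Kosinski, *Differential Manifolds* (1993): VI.12, IX.7.5, IX.8.7, X §6 proof of Prop. 6.2(a)
  (p. 216) and p. 217. [Kosinski1993]
* J. Milnor, *Lectures on the h-cobordism theorem* (1965), §9, Prop. B and Corollary (p. 109).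
  [MilnorHCobordism1965]
* G. Bredon, *Topology and Geometry* (1993), VI.7, Prop. 7.14, Thm. 7.15. [Bredon1993]
* A. Hatcher, *Algebraic Topology* (2002), §3.3, p. 234–236 (two orientations; naturality of
  `[X]`). [HatcherAT2002]
-/

open scoped Manifold ContDiff Topology
open Set Function ContinuousMap

noncomputable section

namespace Literature.Topology.FourManifolds

/-! ### Transport of oriented boundaries along homeomorphisms of the boundary model -/

section Transport

universe u

variable {n : ℕ} {W : Type u} [TopologicalSpace W] [ChartedSpace (EuclideanHalfSpace (n + 1)) W]
  [T2Space W] [CompactSpace W] [IsManifold (𝓡∂ (n + 1)) 1 W]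
  {M M' : Type u} [TopologicalSpace M] [TopologicalSpace M']
  [CompactSpace M] [T2Space M] [ChartedSpace (EuclideanSpace ℝ (Fin n)) M]

/-- **Oriented boundaries are natural in the boundary model.** If `(M, μ) = bW` along
`f : M → ∂W` with the orientation `μ̂` of `W` (`IsOrientedBoundary n f hf μ μ̂`: a relative class
`w = [W, ∂W]` with `∂w = f_* [M]_μ` and `q_* w = j_* [Ŵ]_μ̂`) and `e : M' ≃ₜ M` is a homeomorphism
(`M` a closed topological `n`-manifold), then `(M', μ.comap e) = bW` along `f ∘ e` with the same
`μ̂` and the same `w`: `[M']_{μ.comap e} = (e⁻¹)_* [M]_μ` (Hatcher 2002, §3.3, p. 236, naturality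
of the fundamental class; tree theorem `HomologicalOrientation.fundamentalClass_comap_holds`), so
`(f ∘ e)_* [M']_{μ.comap e} = f_* [M]_μ = ∂w`. Kervaire–Milnor 1963, §7 ("`Σ = bM`" for a sphere
given up to oriented diffeomorphism). [cite: HatcherAT2002, §3.3, p. 236 (with Thm. 3.43, p. 253)] -/
theorem IsOrientedBoundary.comp_homeomorph {f : C(M, W)}
    {hf : ∀ x, f x ∈ (𝓡∂ (n + 1)).boundary W}
    {μ : Literature.AlgebraicTopology.SingularHomology.HomologicalOrientation ℤ M n}
    {μ' : Literature.AlgebraicTopology.SingularHomology.HomologicalOrientation ℤ (ClosedModel n W) (n + 1)}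
    (h : IsOrientedBoundary n f hf μ μ') (e : M' ≃ₜ M) :
    IsOrientedBoundary n (f.comp (e : C(M', M))) (fun x => hf (e x)) (μ.comap e) μ' := by
  obtain ⟨w, hw₁, hw₂⟩ := h
  refine ⟨w, hw₁.trans ?_, hw₂⟩
  have hfc : (μ.comap e).fundamentalClass =
      Literature.AlgebraicTopology.SingularHomology.singularHomology.map ℤ ℤ (e.symm : C(M, M')) n
        μ.fundamentalClass := by
    rw [Literature.AlgebraicTopology.SingularHomology.HomologicalOrientation.fundamentalClass_comap_holds
      ℤ M M' n μ e, Literature.AlgebraicTopology.SingularHomology.singularHomology.mapIso_inv]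
  have hmap : (boundaryCorestrict n (f.comp (e : C(M', M))) (fun x => hf (e x))).comp
      (e.symm : C(M, M')) = boundaryCorestrict n f hf := by
    refine ContinuousMap.ext fun x => Subtype.ext ?_
    show f (e (e.symm x)) = f x
    rw [e.apply_symm_apply]
  have hcomp := Literature.AlgebraicTopology.SingularHomology.singularHomology.map_comp ℤ ℤ
    (e.symm : C(M, M')) (boundaryCorestrict n (f.comp (e : C(M', M))) (fun x => hf (e x))) n
  rw [hmap] at hcomp
  rw [hcomp, ModuleCat.comp_apply, hfc]

end Transport

/-! ### Transport of bounding data along a diffeomorphism onto the standard sphere -/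

namespace HomotopySphere

variable {n : ℕ}

/-- **Signatures of bounding s-parallelizable manifolds are transported along diffeomorphisms onto
`𝕊ⁿ`.** Let `Σ` be an oriented homotopy `n`-sphere (`n ≠ 0`), `σ ∈ signatureSet g m h Σ` (so
`σ = σ(M)` for some s-parallelizable `M` with `bM = Σ` as oriented manifolds,
`HomotopySpheresSignature.lean`) and `ψ : Σ ≅ 𝕊ⁿ` a diffeomorphism (no orientation condition).
GIVEN Bredon's VI.7.15 for `𝕊ⁿ` (`SmoothOrientation.existsUnique_isCompatible n 𝕊ⁿ`: a smooth
orientation of `𝕊ⁿ` has a compatible homological orientation), `σ ∈ signatureSet g m h (𝕊ⁿ, o)`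
for some smooth orientation `o` of `𝕊ⁿ`. Proof: keep `M` and its orientation `μ'`, replace the
boundary identification by `incl ∘ ψ⁻¹` (`NullCobordism.comap`) and `μ` by `μ.comap ψ⁻¹`, whose
fundamental class is `ψ_* [Σ]_μ` (`HomologicalOrientation.fundamentalClass_comap_holds`, Hatcher
2002, p. 236), so that the relative class `[M, bM]` still bounds it; on the connected `𝕊ⁿ` the
transported orientation is `±` the one compatible with a fixed `o₀`
(`HomologicalOrientation.eq_or_eq_neg_of_connected_holds`, Hatcher p. 234), hence compatible with
`o₀` or with `-o₀` (`SmoothOrientation.IsCompatible.neg`). This is the (tacit) invariance of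
Kervaire–Milnor's `σ(M) mod σₘ` under diffeomorphism of the bounded sphere (1963, §7, p. 529:
"the collection of all `4m`-manifolds `M₀` which are s-parallelizable and are bounded by the
`(4m-1)`-sphere"), i.e. of Milnor's `λ(M⁷)` (1956, §1, Thm. 1).
[cite: KervaireMilnorAnnals1963, §7, p. 529 (definition of σₘ)] [cite: Bredon1993, VI.7, Thm. 7.15] [cite: HatcherAT2002, §3.3, pp. 234–236] -/
theorem exists_mem_signatureSet_sphere_of_diffeomorph (hn : n ≠ 0)
    (hB : SmoothOrientation.existsUnique_isCompatible n (Metric.sphere (0 : EuclideanSpace ℝ (Fin (n + 1))) 1))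
    {g : Literature.AlgebraicTopology.SingularHomology.HomologicalOrientation ℤ (EuclideanSpace ℝ (Fin n)) n} {m : ℕ}
    {h : n + 1 = 4 * m} {S : HomotopySphere n} {σ : ℤ} (hσ : σ ∈ signatureSet g m h S)
    (ψ : S.carrier ≃ₘ⟮𝓡 n, 𝓡 n⟯ (Metric.sphere (0 : EuclideanSpace ℝ (Fin (n + 1))) 1)) :
    ∃ o : SmoothOrientation (𝓡 n) (Metric.sphere (0 : EuclideanSpace ℝ (Fin (n + 1))) 1), σ ∈ signatureSet g m h ⟨Metric.sphere (0 : EuclideanSpace ℝ (Fin (n + 1))) 1, o, ⟨.refl _⟩⟩ := by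
  obtain ⟨μ, c, μ', -, hspar, hob, hsig⟩ := hσ
  -- the transported data: the same `W`, glued to `𝕊ⁿ` along `incl ∘ ψ⁻¹`, and `ψ_* μ`
  let e : (Metric.sphere (0 : EuclideanSpace ℝ (Fin (n + 1))) 1) ≃ₜ S.carrier := ψ.toHomeomorph.symm
  let c' : NullCobordism n (Metric.sphere (0 : EuclideanSpace ℝ (Fin (n + 1))) 1) := c.comap ψ.symm
  have hob' : c'.IsOrientedBy (μ.comap e) μ' := IsOrientedBoundary.comp_homeomorph hob e
  -- the transported homological orientation is compatible with `o₀` or with `-o₀`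
  obtain ⟨o₀⟩ := (isOrientable_sphere_holds n : Nonempty _)
  obtain ⟨μ₁, hμ₁, -⟩ := hB g o₀
  haveI : ConnectedSpace (Metric.sphere (0 : EuclideanSpace ℝ (Fin (n + 1))) 1) := HomotopySphere.connectedSpace_sphere hn
  rcases Literature.AlgebraicTopology.SingularHomology.HomologicalOrientation.eq_or_eq_neg_of_connected_holds
      (Metric.sphere (0 : EuclideanSpace ℝ (Fin (n + 1))) 1) (μ.comap e) μ₁ with hμ | hμ
  · exact ⟨o₀, μ.comap e, c', μ', hμ ▸ hμ₁, hspar, hob', hsig⟩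
  · exact ⟨-o₀, μ.comap e, c', μ', hμ ▸ hμ₁.neg, hspar, hob', hsig⟩

end HomotopySphere

/-! ### spc4.S12 from the signature leaves -/

/-- **Milnor's exotic 7-sphere from the three signature leaves and Bredon VI.7.15.** GIVEN
(i) `HomotopySphere.exists_eight_mem_signatureSet` (some homotopy `7`-sphere bounds an oriented
s-parallelizable `8`-manifold of signature `8`: Milnor's `E₈`-plumbing, Kosinski 1993, X.6 p. 216),
(ii) `HomotopySphere.twoHundredTwentyFour_dvd_of_mem_signatureSet_sphere` (every such signature for
the standard `𝕊⁷` is a multiple of `224`: signature theorem, Kervaire–Milnor 1963, pp. 529–530,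
Kosinski IX.8.7), (iii) `SmoothOrientation.existsUnique_isCompatible 7 𝕊⁷` (Bredon 1993, VI.7.15)
and (iv) `nonempty_homeomorph_sphere_of_homologySphere_of_five_le` (Milnor 1965, §9, Prop. B), there
is a smooth `7`-manifold homeomorphic but not diffeomorphic to `𝕊⁷`
(`exists_homeomorph_isEmpty_diffeomorph_sphere_seven`; Milnor 1956, Thm. 3): the sphere `Σ` of (i) is
homeomorphic to `𝕊⁷` by (iv) (`HomotopySphere.nonempty_homeomorph_sphere_of_propB`); were it
diffeomorphic to `𝕊⁷`, its signature `8` would occur for the standard sphere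
(`HomotopySphere.exists_mem_signatureSet_sphere_of_diffeomorph`, using (iii)), contradicting (ii),
`224 ∤ 8` — Milnor's argument of §1 and §3 with `λ` replaced by `σ mod 224`.
[cite: Milnor1956, Thm. 3 (p. 403), with §1 Thm. 1 and §3] [cite: KervaireMilnorAnnals1963, §7, pp. 529–530] -/
theorem exists_homeomorph_isEmpty_diffeomorph_sphere_seven_of_signature_leaves
    (hE8 : HomotopySphere.exists_eight_mem_signatureSet)
    (h224 : HomotopySphere.twoHundredTwentyFour_dvd_of_mem_signatureSet_sphere)
    (hB : SmoothOrientation.existsUnique_isCompatible 7 (Metric.sphere (0 : EuclideanSpace ℝ (Fin 8)) 1))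
    (hPB : nonempty_homeomorph_sphere_of_homologySphere_of_five_le.{0}) :
    exists_homeomorph_isEmpty_diffeomorph_sphere_seven := by
  by_contra hne
  obtain ⟨g⟩ := isOrientableOver_int_euclideanSpace 7
  have h : (7 : ℕ) + 1 = 4 * 2 := by norm_num
  obtain ⟨S, hS⟩ := hE8 7 2 h (by norm_num) g
  obtain ⟨homeo⟩ := HomotopySphere.nonempty_homeomorph_sphere_of_propB hPB (by norm_num) S
  have hψ : Nonempty (S.carrier ≃ₘ⟮𝓡 7, 𝓡 7⟯ (Metric.sphere (0 : EuclideanSpace ℝ (Fin 8)) 1)) := by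
    by_contra hS'
    exact hne ⟨S.carrier, inferInstance, inferInstance, inferInstance, homeo,
      not_nonempty_iff.mp hS'⟩
  obtain ⟨ψ⟩ := hψ
  obtain ⟨o, ho⟩ :=
    HomotopySphere.exists_mem_signatureSet_sphere_of_diffeomorph (by norm_num) hB hS ψ
  have h8 : (224 : ℤ) ∣ 8 := h224 g h o 8 ho
  omega

/-- **Milnor's exotic 7-sphere from the `E₈`-plumbing leaf.** As
`exists_homeomorph_isEmpty_diffeomorph_sphere_seven_of_signature_leaves`, with "`8` occurs" replaced
by its geometric half `HomotopySphere.exists_intersectionForm_equivalent_e8Form` (Kosinski 1993,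
VI.12: `M(4m)` has intersection matrix `Γ₈` and bounds a homotopy sphere; IX.7.5: it is
parallelizable), the algebraic half `σ(E₈) = 8` being the tree theorem `signature_e8Form_holds`
(`HomotopySphere.exists_eight_mem_signatureSet_of`). These four hypotheses are the remaining debt
behind spc4.S12 on this route. [cite: Milnor1956, Thm. 3 (p. 403)] [cite: Kosinski1993, VI.12 (p. 140) and Ch. X §6, proof of Prop. 6.2(a) (p. 216)] -/
theorem exists_homeomorph_isEmpty_diffeomorph_sphere_seven_of_e8_leaves
    (hΓ : HomotopySphere.exists_intersectionForm_equivalent_e8Form)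
    (h224 : HomotopySphere.twoHundredTwentyFour_dvd_of_mem_signatureSet_sphere)
    (hB : SmoothOrientation.existsUnique_isCompatible 7 (Metric.sphere (0 : EuclideanSpace ℝ (Fin 8)) 1))
    (hPB : nonempty_homeomorph_sphere_of_homologySphere_of_five_le.{0}) :
    exists_homeomorph_isEmpty_diffeomorph_sphere_seven :=
  exists_homeomorph_isEmpty_diffeomorph_sphere_seven_of_signature_leaves
    (HomotopySphere.exists_eight_mem_signatureSet_of hΓ signature_e8Form_holds) h224 hB hPB

/-! ### The route through `Θ₇ ≠ 0`, with Prop. B and Thm. 7.5 -/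

/-- **Exotic 7-spheres from `Θ₇ ≠ 0`, on the h-cobordism route.** As
`exists_homeomorph_isEmpty_diffeomorph_sphere_seven_of_nontrivial` (`ExoticSevenSphere.lean`), with
the homeomorphism `Σ ≈ 𝕊⁷` of a homotopy `7`-sphere taken from Smale's theorem in Milnor's
homological form (`nonempty_homeomorph_sphere_of_homologySphere_of_five_le`, Milnor 1965, §9,
Prop. B and Corollary, via `HomotopySphere.nonempty_homeomorph_sphere_of_propB`) instead of the
topological Poincaré conjecture for topological manifolds: if every homotopy `7`-sphere were
diffeomorphic to `𝕊⁷` then `Θ₇` would be a point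
(`HomotopySphereClass.subsingleton_of_nonempty_diffeomorph_sphere`, Kervaire–Milnor 1963, §2
p. 507). [cite: Milnor1956, Thm. 3 (p. 403)] [cite: MilnorHCobordism1965, §9, Prop. B and Corollary (p. 109)] -/
theorem exists_homeomorph_isEmpty_diffeomorph_sphere_seven_of_nontrivial_of_propB
    (hΘ : Nontrivial (HomotopySphereClass 7))
    (hPB : nonempty_homeomorph_sphere_of_homologySphere_of_five_le.{0}) :
    exists_homeomorph_isEmpty_diffeomorph_sphere_seven := by
  by_contra hne
  have hall : ∀ S : HomotopySphere 7, Nonempty (S.carrier ≃ₘ⟮𝓡 7, 𝓡 7⟯ (Metric.sphere (0 : EuclideanSpace ℝ (Fin 8)) 1)) := by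
    intro S
    by_contra hS
    obtain ⟨homeo⟩ := HomotopySphere.nonempty_homeomorph_sphere_of_propB hPB (by norm_num) S
    exact hne ⟨S.carrier, inferInstance, inferInstance, inferInstance, homeo,
      not_nonempty_iff.mp hS⟩
  haveI : Subsingleton (HomotopySphereClass 7) :=
    HomotopySphereClass.subsingleton_of_nonempty_diffeomorph_sphere (by norm_num) hall
  exact false_of_nontrivial_of_subsingleton (HomotopySphereClass 7)

/-- **`224 ∣ σ₂`** from the invariance leaf: every element of Kervaire–Milnor's group of signatures of
s-parallelizable `8`-manifolds bounded by `S⁷` (`HomotopySphere.sphereSignatureSubgroup`, 1963,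
p. 529) is a multiple of `224` GIVEN `HomotopySphere.twoHundredTwentyFour_dvd_of_mem_signatureSet_sphere`
(the subgroup is generated by such signatures), in particular so is its generator
`σ₂ = HomotopySphere.sigmaGen g 2 h` (or `σ₂ = 0`, the junk value, when no signature occurs).
[cite: KervaireMilnorAnnals1963, §7, pp. 529–530 (σₘ)] -/
theorem HomotopySphere.twoHundredTwentyFour_dvd_sigmaGen_of
    (h224 : HomotopySphere.twoHundredTwentyFour_dvd_of_mem_signatureSet_sphere)
    (g : Literature.AlgebraicTopology.SingularHomology.HomologicalOrientation ℤ (EuclideanSpace ℝ (Fin 7)) 7)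
    (h : 7 + 1 = 4 * 2) :
    (224 : ℤ) ∣ (HomotopySphere.sigmaGen g 2 h : ℤ) := by
  have hle : HomotopySphere.sphereSignatureSubgroup g 2 h ≤ AddSubgroup.zmultiples (224 : ℤ) := by
    refine (AddSubgroup.closure_le _).2 fun σ hσ => ?_
    obtain ⟨o, hσ⟩ := mem_iUnion.1 hσ
    exact Int.mem_zmultiples_iff.2 (h224 g h o σ hσ)
  by_cases h0 : HomotopySphere.sigmaGen g 2 h = 0
  · simp [h0]
  · have hmem := Nat.sInf_mem (s := {k : ℕ | 0 < k ∧ (k : ℤ) ∈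
        HomotopySphere.sphereSignatureSubgroup g 2 h}) (Nat.nonempty_of_pos_sInf (Nat.pos_of_ne_zero h0))
    exact Int.mem_zmultiples_iff.1 (hle hmem.2)

/-- **`Θ₇` is nontrivial, from the signature leaves and Kervaire–Milnor's Thm. 7.5.** GIVEN
(i) `HomotopySphere.exists_eight_mem_signatureSet` (`8` occurs for some homotopy `7`-sphere `Σ`),
(ii) `HomotopySphere.twoHundredTwentyFour_dvd_of_mem_signatureSet_sphere` (`224 ∣ σ(M₀)` for
`bM₀ = S⁷`), (iii) Kervaire–Milnor's Thm. 7.5 on classes (`HomotopySphere.mk_eq_mk_iff_sigmaGen_dvd_sub`: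
`[Σ₁] = [Σ₂] ↔ σ₂ ∣ σ(M₁) - σ(M₂)`; only `→` is used) and (iv) Milnor's Prop. B
(`nonempty_homeomorph_sphere_of_homologySphere_of_five_le`, through which the tree proves
`σ(-M) = -σ(M)`, `HomotopySphere.neg_mem_signatureSet_neg_of_propB`), the classes `[Σ] ≠ [-Σ]` in
`Θ₇`: `-8` occurs for `-Σ`, so `[Σ] = [-Σ]` would give `σ₂ ∣ 16` with `224 ∣ σ₂`
(`HomotopySphere.twoHundredTwentyFour_dvd_sigmaGen_of`). Kervaire–Milnor 1963, §7 (Thm. 7.5,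
p. 530: `bP₈ = Θ₇ ≅ ℤ₂₈`, of which this is the first bit); Milnor 1956, Thm. 3.
[cite: KervaireMilnorAnnals1963, Thm. 7.5 (pp. 529–530)] [cite: Milnor1956, Thm. 3 (p. 403)] -/
theorem nontrivial_homotopySphereClass_seven_of_signature_leaves
    (hE8 : HomotopySphere.exists_eight_mem_signatureSet)
    (h224 : HomotopySphere.twoHundredTwentyFour_dvd_of_mem_signatureSet_sphere)
    (h75 : HomotopySphere.mk_eq_mk_iff_sigmaGen_dvd_sub)
    (hPB : nonempty_homeomorph_sphere_of_homologySphere_of_five_le.{0}) :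
    Nontrivial (HomotopySphereClass 7) := by
  obtain ⟨g⟩ := isOrientableOver_int_euclideanSpace 7
  have h : (7 : ℕ) + 1 = 4 * 2 := by norm_num
  obtain ⟨S, hS⟩ := hE8 7 2 h (by norm_num) g
  have hneg : (-8 : ℤ) ∈ HomotopySphere.signatureSet g 2 h S.neg :=
    HomotopySphere.neg_mem_signatureSet_neg_of_propB hPB 7 2 h (by norm_num) g S 8 hS
  refine ⟨⟨HomotopySphereClass.mk S, HomotopySphereClass.mk S.neg, fun heq => ?_⟩⟩
  have hdvd : (HomotopySphere.sigmaGen g 2 h : ℤ) ∣ 8 - -8 :=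
    (h75 7 2 h (by norm_num) g S S.neg 8 (-8) hS hneg).1 heq
  have h16 : (224 : ℤ) ∣ 8 - -8 :=
    (HomotopySphere.twoHundredTwentyFour_dvd_sigmaGen_of h224 g h).trans hdvd
  omega

/-- **Milnor's exotic 7-sphere through `Θ₇ ≠ 0` and Thm. 7.5**: spc4.S12 from the hypotheses of
`nontrivial_homotopySphereClass_seven_of_signature_leaves` (via
`exists_homeomorph_isEmpty_diffeomorph_sphere_seven_of_nontrivial_of_propB`), a second route on which
Kervaire–Milnor's Thm. 7.5 replaces Bredon VI.7.15. [cite: Milnor1956, Thm. 3 (p. 403)] [cite: KervaireMilnorAnnals1963, Thm. 7.5 (pp. 529–530)] -/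
theorem exists_homeomorph_isEmpty_diffeomorph_sphere_seven_of_thm75
    (hE8 : HomotopySphere.exists_eight_mem_signatureSet)
    (h224 : HomotopySphere.twoHundredTwentyFour_dvd_of_mem_signatureSet_sphere)
    (h75 : HomotopySphere.mk_eq_mk_iff_sigmaGen_dvd_sub)
    (hPB : nonempty_homeomorph_sphere_of_homologySphere_of_five_le.{0}) :
    exists_homeomorph_isEmpty_diffeomorph_sphere_seven :=
  exists_homeomorph_isEmpty_diffeomorph_sphere_seven_of_nontrivial_of_propB
    (nontrivial_homotopySphereClass_seven_of_signature_leaves hE8 h224 h75 hPB) hPB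

/-- **spc4.S32⁻ from the signature leaves**: the smooth Poincaré conjecture fails in dimension `7`
(`not_forall_nonemptyDiffeomorphSphere_seven`) under the four hypotheses of
`exists_homeomorph_isEmpty_diffeomorph_sphere_seven_of_signature_leaves`, by
`not_forall_nonemptyDiffeomorphSphere_seven_of` (`ExoticSevenSphere.lean`). Milnor 1956, Thm. 3;
Kervaire–Milnor 1963. [cite: Milnor1956, Thm. 3 (p. 403)] -/
theorem not_forall_nonemptyDiffeomorphSphere_seven_of_signature_leaves
    (hE8 : HomotopySphere.exists_eight_mem_signatureSet)
    (h224 : HomotopySphere.twoHundredTwentyFour_dvd_of_mem_signatureSet_sphere)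
    (hB : SmoothOrientation.existsUnique_isCompatible 7 (Metric.sphere (0 : EuclideanSpace ℝ (Fin 8)) 1))
    (hPB : nonempty_homeomorph_sphere_of_homologySphere_of_five_le.{0}) :
    not_forall_nonemptyDiffeomorphSphere_seven :=
  not_forall_nonemptyDiffeomorphSphere_seven_of
    (exists_homeomorph_isEmpty_diffeomorph_sphere_seven_of_signature_leaves hE8 h224 hB hPB)

/-! ### Bredon VI.7.15 discharged: spc4.S12 on the three deep leaves -/

namespace HomotopySphere

/-- **Signatures are transported along diffeomorphisms onto `𝕊ⁿ`, unconditionally**: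
`HomotopySphere.exists_mem_signatureSet_sphere_of_diffeomorph` with its Bredon hypothesis fed by
the tree theorem `SmoothOrientation.existsUnique_isCompatible_holds` (Bredon 1993, VI.7.15, proved
in `SmoothHomologicalOrientationProofs.lean`): if `σ ∈ signatureSet g m h Σ` and `ψ : Σ ≅ 𝕊ⁿ` is a
diffeomorphism (`n ≠ 0`), then `σ ∈ signatureSet g m h (𝕊ⁿ, o)` for some smooth orientation `o`
of `𝕊ⁿ` — the invariance of Kervaire–Milnor's `σ(M) mod σₘ` (1963, §7, p. 529), i.e. of Milnor's
`λ(M⁷)` (1956, §1, Thm. 1), under diffeomorphism of the bounded sphere.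
[cite: KervaireMilnorAnnals1963, §7, p. 529 (definition of σₘ)] [cite: Bredon1993, VI.7, Thm. 7.15] -/
theorem exists_mem_signatureSet_sphere_of_diffeomorph' {n : ℕ} (hn : n ≠ 0)
    {g : Literature.AlgebraicTopology.SingularHomology.HomologicalOrientation ℤ (EuclideanSpace ℝ (Fin n)) n} {m : ℕ}
    {h : n + 1 = 4 * m} {S : HomotopySphere n} {σ : ℤ} (hσ : σ ∈ signatureSet g m h S)
    (ψ : S.carrier ≃ₘ⟮𝓡 n, 𝓡 n⟯ (Metric.sphere (0 : EuclideanSpace ℝ (Fin (n + 1))) 1)) :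
    ∃ o : SmoothOrientation (𝓡 n) (Metric.sphere (0 : EuclideanSpace ℝ (Fin (n + 1))) 1), σ ∈ signatureSet g m h ⟨Metric.sphere (0 : EuclideanSpace ℝ (Fin (n + 1))) 1, o, ⟨.refl _⟩⟩ :=
  exists_mem_signatureSet_sphere_of_diffeomorph hn SmoothOrientation.existsUnique_isCompatible_holds hσ ψ

end HomotopySphere

/-- **Milnor's exotic 7-sphere from the three deep leaves.** GIVEN
(i) `HomotopySphere.exists_eight_mem_signatureSet` (a homotopy `7`-sphere bounds an oriented
s-parallelizable `8`-manifold of signature `8`: the `E₈`-plumbing, Kosinski 1993, X.6 p. 216),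
(ii) `HomotopySphere.twoHundredTwentyFour_dvd_of_mem_signatureSet_sphere` (`224 ∣ σ(M₀)` whenever
`bM₀ = S⁷`, `M₀` s-parallelizable: Kervaire–Milnor 1963, pp. 529–530) and
(iii) `nonempty_homeomorph_sphere_of_homologySphere_of_five_le` (Milnor 1965, §9, Prop. B), there is
a smooth `7`-manifold homeomorphic but not diffeomorphic to `𝕊⁷` (Milnor 1956, Thm. 3):
`exists_homeomorph_isEmpty_diffeomorph_sphere_seven_of_signature_leaves` with its fourth input,
Bredon VI.7.15 on `𝕊⁷`, supplied by `SmoothOrientation.existsUnique_isCompatible_holds`. These three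
hypotheses are exactly the named facts still open behind spc4.S12 on this route.
[cite: Milnor1956, Thm. 3 (p. 403), with §1 Thm. 1 and §3] [cite: KervaireMilnorAnnals1963, §7, pp. 529–530] -/
theorem exists_homeomorph_isEmpty_diffeomorph_sphere_seven_of_three_leaves
    (hE8 : HomotopySphere.exists_eight_mem_signatureSet)
    (h224 : HomotopySphere.twoHundredTwentyFour_dvd_of_mem_signatureSet_sphere)
    (hPB : nonempty_homeomorph_sphere_of_homologySphere_of_five_le.{0}) :
    exists_homeomorph_isEmpty_diffeomorph_sphere_seven :=
  exists_homeomorph_isEmpty_diffeomorph_sphere_seven_of_signature_leaves hE8 h224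
    SmoothOrientation.existsUnique_isCompatible_holds hPB

/-- **Milnor's exotic 7-sphere from the `E₈`-plumbing leaf, the invariance leaf and Prop. B**:
`exists_homeomorph_isEmpty_diffeomorph_sphere_seven_of_e8_leaves` with Bredon VI.7.15 supplied by
`SmoothOrientation.existsUnique_isCompatible_holds`; the geometric `E₈` leaf
`HomotopySphere.exists_intersectionForm_equivalent_e8Form` (Kosinski 1993, VI.12 and IX.7.5) and
`σ(E₈) = 8` (`signature_e8Form_holds`) give hypothesis (i) of
`exists_homeomorph_isEmpty_diffeomorph_sphere_seven_of_three_leaves`. When the three leaves are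
discharged, `exists_homeomorph_isEmpty_diffeomorph_sphere_seven_holds` is this theorem applied to
their `_holds`. [cite: Milnor1956, Thm. 3 (p. 403)] [cite: Kosinski1993, VI.12 (p. 140) and Ch. X §6, proof of Prop. 6.2(a) (p. 216)] -/
theorem exists_homeomorph_isEmpty_diffeomorph_sphere_seven_of_e8_three_leaves
    (hΓ : HomotopySphere.exists_intersectionForm_equivalent_e8Form)
    (h224 : HomotopySphere.twoHundredTwentyFour_dvd_of_mem_signatureSet_sphere)
    (hPB : nonempty_homeomorph_sphere_of_homologySphere_of_five_le.{0}) :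
    exists_homeomorph_isEmpty_diffeomorph_sphere_seven :=
  exists_homeomorph_isEmpty_diffeomorph_sphere_seven_of_e8_leaves hΓ h224
    SmoothOrientation.existsUnique_isCompatible_holds hPB

/-- **spc4.S32⁻ from the three deep leaves**: the smooth Poincaré conjecture fails in dimension `7`
(`not_forall_nonemptyDiffeomorphSphere_seven`) under the hypotheses of
`exists_homeomorph_isEmpty_diffeomorph_sphere_seven_of_three_leaves`. Milnor 1956, Thm. 3.
[cite: Milnor1956, Thm. 3 (p. 403)] -/
theorem not_forall_nonemptyDiffeomorphSphere_seven_of_three_leaves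
    (hE8 : HomotopySphere.exists_eight_mem_signatureSet)
    (h224 : HomotopySphere.twoHundredTwentyFour_dvd_of_mem_signatureSet_sphere)
    (hPB : nonempty_homeomorph_sphere_of_homologySphere_of_five_le.{0}) :
    not_forall_nonemptyDiffeomorphSphere_seven :=
  not_forall_nonemptyDiffeomorphSphere_seven_of
    (exists_homeomorph_isEmpty_diffeomorph_sphere_seven_of_three_leaves hE8 h224 hPB)

end Literature.Topology.FourManifolds

end
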